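import Literature.Analysis.FluidPDE.Seregin2023.TypeIIEulerZoomScenario
import Literature.Analysis.FluidPDE.CKNVelocityIntegrability
import Literature.Analysis.FluidPDE.LerayHopfH1Test
import Literature.Analysis.FluidPDE.LocalTypeIScaling
import Literature.Analysis.FluidPDE.LocalTypeIProofs
import HarnessLib

/-!
# Seregin 2026, Theorem 2.1 (the Type II scenario (1.3) ∧ (1.7) is impossible) — PROVED, for
# continuous scenario weights

G. Seregin, *On potential Type II blowups for the Navier–Stokes equations*, arXiv:2606.29468 (2026)
[`Seregin2026`], **Theorem 2.1** (p. 5), with its printed proof (pp. 6–7). The sibling statements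
file `TypeIIEulerZoomScenario.lean` types the theorem as the named fact
`seregin2026_typeII_scenario_excluded` over the weight class `IsScenarioWeight f F` (p. 4 and
(2.2): `f : ]0,1] → ]0,1]` "monotonically increasing", `f(0+) = 0`, `f(1) = 1`,
`F(a) = liminf_{λ→0} f(λa)/f(λ) > 0`). This file PROVES the theorem, following the printed proof
line by line, under the one hypothesis the printed proof uses silently: **`f` is continuous on
`]0,1]`**.

## Why continuity (the gap in the letter of the source)

The proof (p. 6) chooses, for each radius `r_k` of the scenario, a zoom parameter `λ_k` with
"`λ = λ_k`, `r_k = λ_k √(f(λ_k))`", i.e. it inverts `φ(λ) = λ √(f(λ))`; with `f` merely monotone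
`φ` may jump, its range may miss a sequence of intervals accumulating at `0`, and on those radii the
growth relation (2.4) (which only constrains `g` on the range of `φ`) says nothing about `g` — the
conclusion (2.5) `g(r) M^{s,l}_κ(v,r) → 0` over ALL `r → 0` then fails for suitable (even constant)
`v` and a `g` that is large off the range of `φ`. All weights the source has in view are continuous
(`f(r) = r^{1-m}` of [Seregin2023] = arXiv:2304.04045, `f = 1/ln^γ(e/λ)` (2.10),
`f = λ^{α-1}/ln^γ(e/λ)` (3.9)), and for continuous strictly increasing `f` with `f(0+) = 0`,
`f(1) = 1` the map `φ` is a bijection of `]0,1]` (intermediate value theorem), which is all the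
proof needs. The corrected statement is vendored here under a NEW name,
`seregin2026_typeII_scenario_excluded_continuousWeight` (= the typed Thm 2.1 with the extra binder
`ContinuousOn f (Ioc 0 1)`), and discharged: `seregin2026_typeII_scenario_excluded_continuousWeight_holds`.

## The printed proof and its rendering (pp. 6–7; every object lives in the unit cylinder `Q`)

No compactness and no use of the Navier–Stokes equation, the local energy inequality or the
pressure is needed for Theorem 2.1 (the compactness bullets on p. 7 serve Theorem 3.1); the
argument is:

* (2.7) the Euler zoom `v^λ(y,τ) = λ f(λ) v(λy, λ²f(λ)τ)` (tree: `(λ f(λ)) • stPull (λ²f(λ)) λ 0 0 v`,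
  weak gradient `(λ²f(λ)) • stPull … G` by `HasWeakSpatialGradientOn.stRescale`);
* (2.8) `∫_{-1}^0 (∫_{B(√f(λ))} |v^λ|^s dy)^{l/s} dτ = f(λ)^{(l/2)(1+3/s)} M^{s,l}_κ(v, λ√f(λ))`
  (`zoom_floor_eq`: the exponent bookkeeping `l - 3l/s - 2 + κ = 0`, `l - 1 + κ/2 = (l/2)(1+3/s)`);
* (2.9) at `a = 1` (where `F_λ(1) = f(λ)/f(λ) = 1`): (1.7) at the radius `r = λ` gives
  `ess sup_τ ∫_{B(1)} |v^λ|² ≤ M₁` and `∫_{Q(1)} |∇v^λ|² ≤ M₁` (`zoom_slice_energy_le`,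
  `zoom_grad_le`);
* "known multiplicative inequalities": `‖v^λ‖_{p(η),q(η),Q} ≤ ‖v^λ‖^η_{6,2,Q} ‖v^λ‖^{1-η}_{10/3,Q} ≤ c₁`;
  rendered slice-wise (the same inequality): Sobolev `H¹(B(1)) ⊂ L⁶(B(1))` (tree
  `exists_eLpNorm_six_le_ball`, Lemarié-Rieusset 2016 (13.17)) and Lebesgue interpolation
  `‖·‖_p ≤ ‖·‖₂^θ ‖·‖₆^{1-θ}`, `θ = 3/p - 1/2` (tree `eLpNorm_le_eLpNorm_two_rpow_mul_eLpNorm_six_rpow`,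
  Robinson–Rodrigo–Sadowski 2016 Thm 1.5); `(1-θ) q(η) = 2` is the identity `3/p(η) + 2/q(η) = 3/2`;
* "Hölder inequality one more time": on the small ball `B(√f(λ)) ⊆ B(1)` in space (the factor
  `|B(√f)|^{(1/s - 1/p)l} ∝ f^{(3/2)(1 - s/p)(l/s)}`) and over `]-1,0[` in time (`l < q(η)`); the
  generic estimate is `exists_mixedNorm_smallBall_le` (the time step uses `x^r ≤ 1 + x²` for
  `r = (1-θ)l < 2` instead of Hölder — only the constant changes);
* hence `M^{s,l}_κ(v, φ(λ)) ≤ c f(λ)^{-e}`, `e = (l/2)(1+3/s) - (3/2)(1 - s/p(η))(l/s)`, so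
  `g(φ(λ)) M^{s,l}_κ(v, φ(λ)) ≤ c / (f(λ)^e g(φ(λ))^{-1}) → 0` by (2.4) (`tendsto_zoomScale`), and
  (2.5) follows by the substitution `r = φ(λ)` (`exists_inverse_zoomScale`, the step needing
  continuity). The source argues by contradiction along `r_k`; the direct form is the same estimate.

## Mathlib / tree search

`lean search` for `interpolation eLpNorm two six`, `Sobolev ball`, `stPull`, `time affine`,
`parabolicCylinder_zero`: all analytic inputs are in the tree (files `CKNVelocityIntegrability`,
`LerayHopfH1Test`, `SpaceTimeRescaling`, `LocalTypeIScaling`, `LocalTypeIProofs`) or Mathlib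
(`eLpNorm_le_eLpNorm_mul_rpow_measure_univ`, `Measure.addHaar_ball`, `intermediate_value_Icc`);
no prior typing of a continuous-weight Thm 2.1 (`lean search 'scenario_excluded'`: only the named
fact and its in-tree users `PolynomialScenarioExcluded.lean`, `Seregin2024AxisymTypeIIScenarioReduction.lean`).

## References

* G. Seregin, arXiv:2606.29468 (2026), Thm 2.1 (p. 5), proof pp. 6–7. [`Seregin2026`]
* G. Seregin, arXiv:2304.04045 = Commun. Pure Appl. Anal. 23 (2024), §2. [`Seregin2023`]
* P. G. Lemarié-Rieusset, *The Navier–Stokes Problem in the 21st Century* (2016), (13.17)–(13.18).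
* J. C. Robinson, J. L. Rodrigo, W. Sadowski, *The Three-Dimensional Navier–Stokes Equations* (2016), Thm 1.5.
-/

noncomputable section

open _root_.MeasureTheory _root_.Set _root_.Filter _root_.Metric _root_.Function
  _root_.TopologicalSpace
open scoped _root_.ENNReal _root_.NNReal _root_.Topology

namespace Literature.Analysis.FluidPDE.Seregin2023

/-! ## A. The unit-cylinder estimate ("known multiplicative inequalities" + Hölder on a small ball) -/

section UnitCylinder

/-- `x^r ≤ 1 + x²` in `ℝ≥0∞` for `0 ≤ r ≤ 2`. [folklore] -/
private theorem rpow_le_one_add_sq (x : ℝ≥0∞) {r : ℝ} (hr0 : 0 ≤ r) (hr2 : r ≤ 2) :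
    x ^ r ≤ 1 + x ^ (2 : ℝ) := by
  rcases le_total x 1 with hx | hx
  · exact (ENNReal.rpow_le_one hx hr0).trans le_self_add
  · exact (ENNReal.rpow_le_rpow_of_exponent_le hx hr2).trans le_add_self

/-- **The unit-cylinder estimate** ([Seregin2026] p. 7: "known multiplicative inequalities … lead
to `‖v^λ‖_{p(η),q(η),Q} ≤ c₁`" and "making use of Hölder inequality one more time"). Let `w` have a
weak spatial gradient `Gw` on `Q = Q(0,1) = ]-1,0[ × B(0,1)` with `∫_{B(0,1)} |w(t)|² ≤ A` for
a.e. `t` and `∫_Q |Gw|² ≤ E`. For `2 ≤ p ≤ 6`, `0 < s < p`, `0 < l` and `l (3/2 - 3/p) < 2` there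
is `C = C(A, E, s, p, l)` (independent of `w`) with, for every `0 < ρ ≤ 1`,
`∫_{-1}^0 (∫_{B(0,ρ)} |w|^s dy)^{l/s} dt ≤ C ρ^{3 l (1/s - 1/p)}`. Slice-wise: Hölder on `B(ρ)`
(`‖w(t)‖_{L^s(B_ρ)} ≤ |B_ρ|^{1/s-1/p} ‖w(t)‖_{L^p(B_1)}`), interpolation
`‖·‖_p ≤ ‖·‖₂^θ ‖·‖₆^{1-θ}` and Sobolev `‖w(t)‖₆ ≤ 2 C_S (A + ∫_{B_1}|Gw(t)|²)^{1/2}`; then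
`h^r ≤ 1 + h²` for `r = (3/2 - 3/p) l < 2` and Tonelli.
[cite: Seregin2026, proof of Thm 2.1, p. 7] -/
theorem exists_mixedNorm_smallBall_le (A E : ℝ≥0) {s p l : ℝ} (hs : 0 < s) (hsp : s < p)
    (h2p : 2 ≤ p) (hp6 : p ≤ 6) (hl : 0 < l) (hlq : l * (3 / 2 - 3 / p) < 2) :
    ∃ C : ℝ≥0, ∀ (w : ℝ → EuclideanSpace ℝ (Fin 3) → EuclideanSpace ℝ (Fin 3))
      (Gw : ℝ → EuclideanSpace ℝ (Fin 3) → EuclideanSpace ℝ (Fin 3) →L[ℝ] EuclideanSpace ℝ (Fin 3)),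
      HasWeakSpatialGradientOn
        (parabolicCylinderOpens 1 (0 : ℝ × EuclideanSpace ℝ (Fin 3))) w Gw →
      (∀ᵐ t ∂(volume.restrict (Ioo (-1 : ℝ) 0)),
        ∫⁻ x in ball (0 : EuclideanSpace ℝ (Fin 3)) 1, ‖w t x‖ₑ ^ 2 ≤ (A : ℝ≥0∞)) →
      (∫⁻ z in parabolicCylinder 1 (0 : ℝ × EuclideanSpace ℝ (Fin 3)),
        ENNReal.ofReal (frobeniusNormSq (Gw z.1 z.2)) ≤ (E : ℝ≥0∞)) →
      ∀ ρ ∈ Ioc (0 : ℝ) 1,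
        ∫⁻ t in Ioo (-1 : ℝ) 0,
            (∫⁻ x in ball (0 : EuclideanSpace ℝ (Fin 3)) ρ, ‖w t x‖ₑ ^ s) ^ (l / s) ≤
          (C : ℝ≥0∞) * ENNReal.ofReal (ρ ^ (3 * l * (1 / s - 1 / p))) := by
  classical
  obtain ⟨CS, hCS⟩ := exists_eLpNorm_six_le_ball (E := EuclideanSpace ℝ (Fin 3))
    finrank_euclideanSpace_fin (0 : EuclideanSpace ℝ (Fin 3)) 1
  -- exponents
  have hp0 : 0 < p := lt_of_lt_of_le two_pos h2p
  set θ : ℝ := 3 / p - 1 / 2 with hθ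
  set θ' : ℝ := 3 / 2 - 3 / p with hθ'
  have hθ0 : 0 ≤ θ := by
    rw [hθ, sub_nonneg, div_le_div_iff₀ (by norm_num) hp0]; linarith
  have hθ'0 : 0 ≤ θ' := by
    rw [hθ', sub_nonneg, div_le_div_iff₀ hp0 (by norm_num)]; linarith
  set a : ℝ := 1 / s - 1 / p with ha
  have ha0 : 0 ≤ a := by
    rw [ha, sub_nonneg]; exact one_div_le_one_div_of_le hs hsp.le
  set r : ℝ := θ' * l with hr
  have hr0 : 0 ≤ r := mul_nonneg hθ'0 hl.le
  have hr2 : r ≤ 2 := by rw [hr, mul_comm]; exact hlq.le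
  -- the unit ball and its volume
  set B : Set (EuclideanSpace ℝ (Fin 3)) := ball (0 : EuclideanSpace ℝ (Fin 3)) 1 with hB
  set B1 : ℝ≥0∞ := volume B with hB1
  have hB1top : B1 ≠ ∞ := measure_ball_lt_top.ne
  -- the constant
  set K₁ : ℝ≥0∞ := (((A : ℝ≥0∞) ^ (1 / 2 : ℝ)) ^ θ) ^ l * ((((2 * CS : ℝ≥0) : ℝ≥0∞)) ^ θ') ^ l
    with hK₁
  have hK₁top : K₁ ≠ ∞ := by
    refine ENNReal.mul_ne_top ?_ ?_
    · exact ENNReal.rpow_ne_top_of_nonneg hl.le (ENNReal.rpow_ne_top_of_nonneg hθ0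
        (ENNReal.rpow_ne_top_of_nonneg (by norm_num) ENNReal.coe_ne_top))
    · exact ENNReal.rpow_ne_top_of_nonneg hl.le
        (ENNReal.rpow_ne_top_of_nonneg hθ'0 ENNReal.coe_ne_top)
  set K : ℝ≥0∞ := K₁ * (1 + (A : ℝ≥0∞) + E) * (B1 ^ a) ^ l with hK
  have hKtop : K ≠ ∞ := by
    refine ENNReal.mul_ne_top (ENNReal.mul_ne_top hK₁top ?_) ?_
    · exact ENNReal.add_ne_top.2 ⟨ENNReal.add_ne_top.2 ⟨ENNReal.one_ne_top, ENNReal.coe_ne_top⟩,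
        ENNReal.coe_ne_top⟩
    · exact ENNReal.rpow_ne_top_of_nonneg hl.le (ENNReal.rpow_ne_top_of_nonneg ha0 hB1top)
  refine ⟨K.toNNReal, fun w Gw hGw hA hE ρ hρ => ?_⟩
  rw [ENNReal.coe_toNNReal hKtop]
  have hρ0 : 0 < ρ := hρ.1
  -- notation
  set I : Set ℝ := Ioo (-1 : ℝ) 0 with hI
  set BO : Opens (EuclideanSpace ℝ (Fin 3)) := ⟨ball (0 : EuclideanSpace ℝ (Fin 3)) 1, isOpen_ball⟩
    with hBO
  set Bρ : Set (EuclideanSpace ℝ (Fin 3)) := ball (0 : EuclideanSpace ℝ (Fin 3)) ρ with hBρ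
  have hBρB : Bρ ⊆ B := ball_subset_ball hρ.2
  set e : ℝ → ℝ≥0∞ := fun t => ∫⁻ x in B, ENNReal.ofReal (frobeniusNormSq (Gw t x)) with he
  -- the cylinder as a time cylinder over the unit ball
  have hQ : parabolicCylinder 1 (0 : ℝ × EuclideanSpace ℝ (Fin 3)) = I ×ˢ B := by
    rw [SuitableCompactness.parabolicCylinder_zero, hI, hB]; norm_num
  have hGw' : HasWeakSpatialGradientOn (timeCylinder BO (-1) 0) w Gw := by
    have e1 : timeCylinder BO (-1) 0 = parabolicCylinderOpens 1 (0 : ℝ × EuclideanSpace ℝ (Fin 3)) := by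
      rw [hBO, ← SuitableCompactness.timeCylinder_ball_eq 1]; norm_num
    rw [e1]; exact hGw
  -- measurability on the cylinder and Tonelli for the dissipation
  have hsubQ : I ×ˢ B ⊆ (parabolicCylinderOpens 1 (0 : ℝ × EuclideanSpace ℝ (Fin 3)) :
      Set (ℝ × EuclideanSpace ℝ (Fin 3))) := by
    rw [coe_parabolicCylinderOpens, hQ]
  have hGm : AEStronglyMeasurable (uncurry Gw) (volume.restrict (I ×ˢ B)) :=
    (hGw.locallyIntegrableOn_grad.mono_set hsubQ).aestronglyMeasurable
  have hprod : (volume.restrict (I ×ˢ B) : Measure (ℝ × EuclideanSpace ℝ (Fin 3))) =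
      (volume.restrict I).prod (volume.restrict B) := by
    rw [Measure.volume_eq_prod, Measure.prod_restrict]
  have hGm2 : AEMeasurable (fun q : ℝ × EuclideanSpace ℝ (Fin 3) =>
      ENNReal.ofReal (frobeniusNormSq (Gw q.1 q.2))) ((volume.restrict I).prod (volume.restrict B)) := by
    rw [← hprod]
    exact (continuous_frobeniusNormSq'.comp_aestronglyMeasurable hGm).aemeasurable.ennreal_ofReal
  have hem : AEMeasurable e (volume.restrict I) := hGm2.lintegral_prod_right'
  have hEeq : ∫⁻ z in I ×ˢ B, ENNReal.ofReal (frobeniusNormSq (Gw z.1 z.2)) = ∫⁻ t in I, e t := by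
    rw [Measure.volume_eq_prod, setLIntegral_prod _ (by rwa [← Measure.prod_restrict])]
  have hEI : ∫⁻ t in I, e t ≤ E := by rw [← hEeq, ← hQ]; exact hE
  -- a.e. in time: weak derivative of the slice and the energy bound
  have h3 : ∀ᵐ t ∂(volume.restrict I), FunctionSpaces.HasWeakFDerivOn BO volume (w t) (Gw t) :=
    hGw'.ae_hasWeakFDerivOn_slice
  -- the slice-wise estimate
  have hpt : ∀ᵐ t ∂(volume.restrict I),
      (∫⁻ x in Bρ, ‖w t x‖ₑ ^ s) ^ (l / s) ≤
        K₁ * (1 + (A : ℝ≥0∞) + e t) * ((volume Bρ) ^ a) ^ l := by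
    filter_upwards [hA, h3] with t hat hwt
    -- measures and measurability of the slice
    have hwm : AEStronglyMeasurable (w t) (volume.restrict B) :=
      hwt.locallyIntegrableOn.aestronglyMeasurable
    have hwmρ : AEStronglyMeasurable (w t) (volume.restrict Bρ) :=
      hwm.mono_measure (Measure.restrict_mono hBρB le_rfl)
    -- `‖w t‖_{L²(B)} ≤ A^{1/2}`
    have hN2 : eLpNorm (w t) 2 (volume.restrict B) ≤ (A : ℝ≥0∞) ^ (1 / 2 : ℝ) := by
      rw [eLpNorm_eq_lintegral_rpow_enorm_toReal two_ne_zero ENNReal.ofNat_ne_top,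
        ENNReal.toReal_ofNat, one_div]
      refine ENNReal.rpow_le_rpow ?_ (by norm_num)
      have e2 : ∫⁻ x in B, ‖w t x‖ₑ ^ (2 : ℝ) = ∫⁻ x in B, ‖w t x‖ₑ ^ 2 := by
        refine lintegral_congr fun x => ?_
        rw [show (2 : ℝ) = ((2 : ℕ) : ℝ) by norm_num, ENNReal.rpow_natCast]
      rw [e2]; exact hat
    have hN2' : eLpNorm (w t) 2 (volume.restrict B) ≠ ∞ :=
      ne_top_of_le_ne_top (ENNReal.rpow_ne_top_of_nonneg (by norm_num) ENNReal.coe_ne_top) hN2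
    -- Sobolev: `‖w t‖_{L⁶(B)} ≤ 2 C_S (A + e t)^{1/2}`
    have hN6 : eLpNorm (w t) 6 (volume.restrict B) ≤
        ((2 * CS : ℝ≥0) : ℝ≥0∞) * ((A : ℝ≥0∞) + e t) ^ (1 / 2 : ℝ) := by
      have h0 := hCS (w t) (Gw t) hwt hN2'
      refine h0.trans ?_
      have h1' : eLpNorm (w t) 2 (volume.restrict B) ≤ ((A : ℝ≥0∞) + e t) ^ (1 / 2 : ℝ) :=
        hN2.trans (ENNReal.rpow_le_rpow le_self_add (by norm_num))
      have h2' : e t ^ (1 / 2 : ℝ) ≤ ((A : ℝ≥0∞) + e t) ^ (1 / 2 : ℝ) :=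
        ENNReal.rpow_le_rpow le_add_self (by norm_num)
      calc (CS : ℝ≥0∞) * (eLpNorm (w t) 2 (volume.restrict B) + e t ^ (1 / 2 : ℝ))
          ≤ CS * (((A : ℝ≥0∞) + e t) ^ (1 / 2 : ℝ) + ((A : ℝ≥0∞) + e t) ^ (1 / 2 : ℝ)) := by
            gcongr
        _ = ((2 * CS : ℝ≥0) : ℝ≥0∞) * ((A : ℝ≥0∞) + e t) ^ (1 / 2 : ℝ) := by
            rw [ENNReal.coe_mul, ENNReal.coe_ofNat]; ring
    -- interpolation: `‖w t‖_{L^p(B)} ≤ ‖w t‖₂^θ ‖w t‖₆^{θ'}`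
    have h2p' : (2 : ℝ≥0∞) ≤ ENNReal.ofReal p := by
      rw [← ENNReal.ofReal_ofNat 2]; exact ENNReal.ofReal_le_ofReal h2p
    have hp6' : ENNReal.ofReal p ≤ 6 := by
      rw [← ENNReal.ofReal_ofNat 6]; exact ENNReal.ofReal_le_ofReal hp6
    have hNp : eLpNorm (w t) (ENNReal.ofReal p) (volume.restrict B) ≤
        ((A : ℝ≥0∞) ^ (1 / 2 : ℝ)) ^ θ *
          (((2 * CS : ℝ≥0) : ℝ≥0∞) * ((A : ℝ≥0∞) + e t) ^ (1 / 2 : ℝ)) ^ θ' := by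
      have hint := eLpNorm_le_eLpNorm_two_rpow_mul_eLpNorm_six_rpow hwm h2p' hp6'
      rw [ENNReal.toReal_ofReal hp0.le] at hint
      refine hint.trans ?_
      gcongr
    -- Hölder on the small ball: `‖w t‖_{L^s(B_ρ)} ≤ |B_ρ|^{1/s-1/p} ‖w t‖_{L^p(B)}`
    have hsp' : ENNReal.ofReal s ≤ ENNReal.ofReal p := ENNReal.ofReal_le_ofReal hsp.le
    have hNs : eLpNorm (w t) (ENNReal.ofReal s) (volume.restrict Bρ) ≤
        eLpNorm (w t) (ENNReal.ofReal p) (volume.restrict B) * (volume Bρ) ^ a := by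
      have h0 := eLpNorm_le_eLpNorm_mul_rpow_measure_univ hsp' hwmρ
      rw [ENNReal.toReal_ofReal hs.le, ENNReal.toReal_ofReal hp0.le, Measure.restrict_apply_univ]
        at h0
      refine h0.trans ?_
      gcongr
    -- `(∫_{B_ρ} |w t|^s)^{l/s} = ‖w t‖_{L^s(B_ρ)}^l`
    have hs0' : ENNReal.ofReal s ≠ 0 := (ENNReal.ofReal_pos.2 hs).ne'
    have hIt : (∫⁻ x in Bρ, ‖w t x‖ₑ ^ s) ^ (l / s) =
        eLpNorm (w t) (ENNReal.ofReal s) (volume.restrict Bρ) ^ l := by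
      rw [eLpNorm_eq_lintegral_rpow_enorm_toReal hs0' ENNReal.ofReal_ne_top,
        ENNReal.toReal_ofReal hs.le, ← ENNReal.rpow_mul]
      congr 1
      ring
    rw [hIt]
    -- assemble the slice estimate
    have hh : ((((A : ℝ≥0∞) + e t) ^ (1 / 2 : ℝ)) ^ θ') ^ l ≤ 1 + (A : ℝ≥0∞) + e t := by
      rw [← ENNReal.rpow_mul _ θ' l]
      refine (rpow_le_one_add_sq _ hr0 hr2).trans ?_
      rw [← ENNReal.rpow_mul, show (1 / 2 : ℝ) * 2 = 1 by norm_num, ENNReal.rpow_one, add_assoc]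
    calc eLpNorm (w t) (ENNReal.ofReal s) (volume.restrict Bρ) ^ l
        ≤ (eLpNorm (w t) (ENNReal.ofReal p) (volume.restrict B) * (volume Bρ) ^ a) ^ l := by
          gcongr
      _ ≤ ((((A : ℝ≥0∞) ^ (1 / 2 : ℝ)) ^ θ *
            (((2 * CS : ℝ≥0) : ℝ≥0∞) * ((A : ℝ≥0∞) + e t) ^ (1 / 2 : ℝ)) ^ θ') *
              (volume Bρ) ^ a) ^ l := by
          gcongr
      _ = K₁ * ((((A : ℝ≥0∞) + e t) ^ (1 / 2 : ℝ)) ^ θ') ^ l * ((volume Bρ) ^ a) ^ l := by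
          rw [hK₁, ENNReal.mul_rpow_of_nonneg _ _ hl.le, ENNReal.mul_rpow_of_nonneg _ _ hl.le,
            ENNReal.mul_rpow_of_nonneg _ _ hθ'0, ENNReal.mul_rpow_of_nonneg _ _ hl.le]
          ring
      _ ≤ K₁ * (1 + (A : ℝ≥0∞) + e t) * ((volume Bρ) ^ a) ^ l := by
          gcongr
  -- integrate in time
  have hIvol : volume I = 1 := by rw [hI, Real.volume_Ioo]; norm_num
  have hVtop : ((volume Bρ) ^ a) ^ l ≠ ∞ :=
    ENNReal.rpow_ne_top_of_nonneg hl.le (ENNReal.rpow_ne_top_of_nonneg ha0 measure_ball_lt_top.ne)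
  have hint : ∫⁻ t in I, (∫⁻ x in Bρ, ‖w t x‖ₑ ^ s) ^ (l / s) ≤
      K₁ * (1 + (A : ℝ≥0∞) + E) * ((volume Bρ) ^ a) ^ l := by
    calc ∫⁻ t in I, (∫⁻ x in Bρ, ‖w t x‖ₑ ^ s) ^ (l / s)
        ≤ ∫⁻ t in I, K₁ * (1 + (A : ℝ≥0∞) + e t) * ((volume Bρ) ^ a) ^ l :=
          lintegral_mono_ae hpt
      _ = K₁ * (∫⁻ t in I, (1 + (A : ℝ≥0∞) + e t)) * ((volume Bρ) ^ a) ^ l := by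
          rw [lintegral_mul_const' _ _ hVtop, lintegral_const_mul' _ _ hK₁top]
      _ = K₁ * ((1 + (A : ℝ≥0∞)) * volume I + ∫⁻ t in I, e t) * ((volume Bρ) ^ a) ^ l := by
          rw [lintegral_add_right' _ hem, lintegral_const, Measure.restrict_apply_univ]
      _ ≤ K₁ * (1 + (A : ℝ≥0∞) + E) * ((volume Bρ) ^ a) ^ l := by
          rw [hIvol, mul_one]
          gcongr
  -- the volume of the small ball: `(|B_ρ|^a)^l = ρ^{3 a l} (|B_1|^a)^l`
  have hvolρ : volume Bρ = ENNReal.ofReal (ρ ^ 3) * B1 := by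
    rw [hBρ, Measure.addHaar_ball volume (0 : EuclideanSpace ℝ (Fin 3)) hρ0.le,
      finrank_euclideanSpace_fin, hB1, hB]
  have hreal : ((ρ ^ 3) ^ a) ^ l = ρ ^ (3 * l * (1 / s - 1 / p)) := by
    rw [← Real.rpow_natCast ρ 3, ← Real.rpow_mul hρ0.le, ← Real.rpow_mul hρ0.le]
    congr 1
    rw [ha]; push_cast; ring
  have hvolρ' : ((volume Bρ) ^ a) ^ l =
      ENNReal.ofReal (ρ ^ (3 * l * (1 / s - 1 / p))) * (B1 ^ a) ^ l := by
    rw [hvolρ, ENNReal.mul_rpow_of_nonneg _ _ ha0, ENNReal.mul_rpow_of_nonneg _ _ hl.le,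
      ENNReal.ofReal_rpow_of_pos (by positivity),
      ENNReal.ofReal_rpow_of_pos (Real.rpow_pos_of_pos (by positivity) _), hreal]
  refine hint.trans (le_of_eq ?_)
  rw [hvolρ', hK]
  ring

end UnitCylinder

/-! ## B. The Euler zoom (2.7) at `a = 1`: weak gradient, the bounds (2.9), the identity (2.8) -/

section Zoom

variable {lam fl : ℝ}

/-- Time change of variables on an interval for lower integrals:
`∫_{]a,b[} H(β t) dt = β⁻¹ ∫_{]βa, βb[} H` (`β > 0`). [folklore] -/
private theorem setLIntegral_Ioo_comp_mul {β : ℝ} (hβ : 0 < β) (a b : ℝ) (H : ℝ → ℝ≥0∞) :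
    ∫⁻ t in Ioo a b, H (β * t) = ENNReal.ofReal β⁻¹ * ∫⁻ τ in Ioo (β * a) (β * b), H τ := by
  have hme := measurableEmbedding_time_affine hβ.ne' 0
  have h1 := hme.restrict_map (volume : Measure ℝ) (Ioo (0 + β * a) (0 + β * b))
  rw [time_affine_preimage_Ioo hβ, map_time_affine_volume hβ, Measure.restrict_smul] at h1
  have h2 := hme.lintegral_map (μ := volume.restrict (Ioo a b)) H
  rw [← h1, lintegral_smul_measure, smul_eq_mul] at h2
  simp only [zero_add] at h2
  exact h2.symm

/-- The unit cylinder is mapped into itself by `Φ(s,y) = (βs, λy)` when `0 < β ≤ 1`,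
`0 < λ ≤ 1`: `Q(0,1) ≤ Φ⁻¹ Q(0,1)`. [folklore] -/
private theorem parabolicCylinderOpens_one_le_stPreimage {β : ℝ} (hβ : 0 < β) (hβ1 : β ≤ 1)
    (hlam : 0 < lam) (hlam1 : lam ≤ 1) :
    parabolicCylinderOpens 1 (0 : ℝ × EuclideanSpace ℝ (Fin 3)) ≤
      stPreimage β lam 0 (0 : EuclideanSpace ℝ (Fin 3))
        (parabolicCylinderOpens 1 (0 : ℝ × EuclideanSpace ℝ (Fin 3))) := by
  intro z hz
  rw [mem_stPreimage]
  have hz' : z ∈ parabolicCylinder 1 (0 : ℝ × EuclideanSpace ℝ (Fin 3)) := hz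
  rw [SuitableCompactness.mem_parabolicCylinder_zero] at hz'
  obtain ⟨⟨h1, h2⟩, h3⟩ := hz'
  show stAffine β lam 0 0 z ∈ parabolicCylinder 1 (0 : ℝ × EuclideanSpace ℝ (Fin 3))
  rw [SuitableCompactness.mem_parabolicCylinder_zero, stAffine_fst, stAffine_snd, zero_add, zero_add,
    norm_smul, Real.norm_eq_abs, abs_of_pos hlam]
  refine ⟨⟨?_, mul_neg_of_pos_of_neg hβ h2⟩, ?_⟩
  · have : 1 * z.1 ≤ β * z.1 := mul_le_mul_of_nonpos_right hβ1 h2.le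
    linarith
  · calc lam * ‖z.2‖ < lam * 1 := mul_lt_mul_of_pos_left (by simpa using h3) hlam
      _ ≤ 1 := by linarith

/-- **(2.7): the Euler zoom has a weak spatial gradient on `Q(0,1)`.** For
`w = (λf) · v ∘ Φ`, `Φ(s,y) = (λ²f s, λy)`, `0 < λ ≤ 1`, `0 < f ≤ 1` (here `f = f(λ)`), the field
`(λf·λ) · G ∘ Φ` is a weak spatial gradient of `w` on `Q(0,1)` (`HasWeakSpatialGradientOn.stRescale`).
[cite: Seregin2026, (2.7) (p. 6)] -/
theorem zoom_hasWeakSpatialGradientOn (hlam : 0 < lam) (hlam1 : lam ≤ 1) (hfl : 0 < fl)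
    (hfl1 : fl ≤ 1) {v : ℝ → EuclideanSpace ℝ (Fin 3) → EuclideanSpace ℝ (Fin 3)}
    {G : ℝ → EuclideanSpace ℝ (Fin 3) → EuclideanSpace ℝ (Fin 3) →L[ℝ] EuclideanSpace ℝ (Fin 3)}
    (hG : HasWeakSpatialGradientOn (parabolicCylinderOpens 1 (0 : ℝ × EuclideanSpace ℝ (Fin 3))) v G) :
    HasWeakSpatialGradientOn (parabolicCylinderOpens 1 (0 : ℝ × EuclideanSpace ℝ (Fin 3)))
      ((lam * fl) • stPull (lam ^ 2 * fl) lam 0 (0 : EuclideanSpace ℝ (Fin 3)) v)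
      ((lam * fl * lam) • stPull (lam ^ 2 * fl) lam 0 (0 : EuclideanSpace ℝ (Fin 3)) G) := by
  have hβ : 0 < lam ^ 2 * fl := by positivity
  have hβ1 : lam ^ 2 * fl ≤ 1 := by
    have : lam ^ 2 ≤ 1 := by nlinarith
    nlinarith
  exact (hG.stRescale (lam * fl) hβ hlam 0 0).mono
    (parabolicCylinderOpens_one_le_stPreimage hβ hβ1 hlam hlam1)

/-- Spatial change of variables for the zoomed slices:
`∫_{B(0,R)} F(λx) dx = λ⁻³ ∫_{B(0,λR)} F` (`λ > 0`). [folklore] -/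
private theorem setLIntegral_ball_comp_smul (hlam : 0 < lam) (R : ℝ) (F : EuclideanSpace ℝ (Fin 3) → ℝ≥0∞) :
    ∫⁻ x in ball (0 : EuclideanSpace ℝ (Fin 3)) R, F (lam • x) =
      ENNReal.ofReal (lam ^ 3)⁻¹ * ∫⁻ y in ball (0 : EuclideanSpace ℝ (Fin 3)) (lam * R), F y := by
  have hpre : (fun x : EuclideanSpace ℝ (Fin 3) => (0 : EuclideanSpace ℝ (Fin 3)) + lam • x) ⁻¹'
      ball (0 : EuclideanSpace ℝ (Fin 3)) (lam * R) = ball (0 : EuclideanSpace ℝ (Fin 3)) R := by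
    rw [space_affine_preimage_ball hlam]
    simp [mul_div_cancel_left₀ R hlam.ne']
  have h := setLIntegral_preimage_comp_space_affine (E := EuclideanSpace ℝ (Fin 3)) hlam 0 F
    (ball (0 : EuclideanSpace ℝ (Fin 3)) (lam * R))
  rw [hpre, finrank_euclideanSpace_fin] at h
  simpa only [zero_add] using h

/-- **(2.9) at `a = 1`, energy: `∫_{B(0,1)} |v^λ(τ)|² ≤ M₁` for a.e. `τ ∈ ]-1,0[`** whenever
`A_f(v, λ) ≤ M` (`F_λ(1) = 1`; the zoomed slice energy at `τ` is `f(λ)²/λ ∫_{B(λ)} |v(λ²f(λ)τ)|²`,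
and `λ²f(λ)τ ∈ ]-λ², 0[`). [cite: Seregin2026, (2.9) (p. 7)] -/
theorem zoom_slice_energy_le (hlam : 0 < lam) {f : ℝ → ℝ} (hfl : 0 < f lam)
    (hfl1 : f lam ≤ 1) {v : ℝ → EuclideanSpace ℝ (Fin 3) → EuclideanSpace ℝ (Fin 3)} {M : ℝ≥0∞}
    (hA : weightedA f lam (0 : ℝ × EuclideanSpace ℝ (Fin 3)) v ≤ M) :
    ∀ᵐ t ∂(volume.restrict (Ioo (-1 : ℝ) 0)),
      ∫⁻ x in ball (0 : EuclideanSpace ℝ (Fin 3)) 1,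
        ‖((lam * f lam) • stPull (lam ^ 2 * f lam) lam 0 (0 : EuclideanSpace ℝ (Fin 3)) v) t x‖ₑ ^ 2
          ≤ M := by
  set β : ℝ := lam ^ 2 * f lam with hβdef
  have hβ : 0 < β := by positivity
  have hβle : β ≤ lam ^ 2 := by
    have : lam ^ 2 * f lam ≤ lam ^ 2 * 1 := mul_le_mul_of_nonneg_left hfl1 (sq_nonneg lam)
    simpa [hβdef] using this
  -- the weighted slice energy of `v`
  set g : ℝ → ℝ≥0∞ := fun t => ENNReal.ofReal (f lam ^ 2 / lam) *
    ∫⁻ x in ball (0 : EuclideanSpace ℝ (Fin 3)) lam, ‖v t x‖ₑ ^ 2 with hg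
  have hA' : essSup g (volume.restrict (Ioo (-lam ^ 2) 0)) ≤ M := by
    have : weightedA f lam (0 : ℝ × EuclideanSpace ℝ (Fin 3)) v =
        essSup g (volume.restrict (Ioo (-lam ^ 2) 0)) := by
      unfold weightedA
      simp only [Prod.fst_zero, Prod.snd_zero, zero_sub, hg]
    rw [← this]; exact hA
  -- restrict the essential supremum to the sub-window `]-β, 0[` and transport it to `]-1, 0[`
  have hsub : Ioo (-β) 0 ⊆ Ioo (-lam ^ 2) 0 := Ioo_subset_Ioo (by linarith) le_rfl
  have h1 : essSup g (volume.restrict (Ioo (-β) 0)) ≤ M :=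
    (essSup_mono_measure' (Measure.restrict_mono hsub le_rfl)).trans hA'
  have h2 : essSup (fun s => g (0 + β * s)) (volume.restrict (Ioo (-1 : ℝ) 0)) =
      essSup g (volume.restrict (Ioo (-β) 0)) := by
    rw [essSup_comp_time_affine hβ 0 (-1) 0 g]
    congr 2
    · simp
  have h3 : ∀ᵐ s ∂(volume.restrict (Ioo (-1 : ℝ) 0)), g (0 + β * s) ≤ M := by
    filter_upwards [ENNReal.ae_le_essSup (fun s => g (0 + β * s))] with s hs
    exact hs.trans ((le_of_eq h2).trans h1)
  filter_upwards [h3] with s hs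
  -- the zoomed slice energy IS `g(β s)`
  have hα : 0 < lam * f lam := by positivity
  have hF : (fun x : EuclideanSpace ℝ (Fin 3) =>
      ‖((lam * f lam) • stPull (lam ^ 2 * f lam) lam 0 (0 : EuclideanSpace ℝ (Fin 3)) v) s x‖ₑ ^ 2) =
      fun x => (fun y : EuclideanSpace ℝ (Fin 3) => ENNReal.ofReal (lam * f lam) ^ 2 *
        ‖v (β * s) y‖ₑ ^ 2) (lam • x) := by
    funext x
    simp only [smul_stPull_apply, zero_add, enorm_smul, mul_pow, Real.enorm_eq_ofReal hα.le, hβdef]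
  rw [hF, setLIntegral_ball_comp_smul hlam 1 (fun y : EuclideanSpace ℝ (Fin 3) =>
    ENNReal.ofReal (lam * f lam) ^ 2 * ‖v (β * s) y‖ₑ ^ 2), mul_one, lintegral_const_mul' _ _ (by simp)]
  rw [zero_add] at hs
  calc ENNReal.ofReal (lam ^ 3)⁻¹ * (ENNReal.ofReal (lam * f lam) ^ 2 *
        ∫⁻ y in ball (0 : EuclideanSpace ℝ (Fin 3)) lam, ‖v (β * s) y‖ₑ ^ 2)
      = g (β * s) := by
        rw [hg, ← mul_assoc, ← ENNReal.ofReal_pow hα.le, ← ENNReal.ofReal_mul (by positivity)]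
        congr 2
        field_simp
    _ ≤ M := hs

/-- **(2.9) at `a = 1`, dissipation: `∫_{Q(0,1)} |∇v^λ|² ≤ E_f(v, λ)`** (the zoomed gradient
is `λ²f(λ) ∇v ∘ Φ`; `Φ(Q(0,1)) = ]-λ²f(λ), 0[ × B(0,λ) ⊆ Q(0,λ)`).
[cite: Seregin2026, (2.9) (p. 6)] -/
theorem zoom_grad_le (hlam : 0 < lam) {f : ℝ → ℝ} (hfl : 0 < f lam) (hfl1 : f lam ≤ 1)
    {G : ℝ → EuclideanSpace ℝ (Fin 3) → EuclideanSpace ℝ (Fin 3) →L[ℝ] EuclideanSpace ℝ (Fin 3)} :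
    ∫⁻ z in parabolicCylinder 1 (0 : ℝ × EuclideanSpace ℝ (Fin 3)),
        ENNReal.ofReal (frobeniusNormSq
          (((lam * f lam * lam) • stPull (lam ^ 2 * f lam) lam 0 (0 : EuclideanSpace ℝ (Fin 3)) G)
            z.1 z.2)) ≤
      weightedE f lam (0 : ℝ × EuclideanSpace ℝ (Fin 3)) G := by
  set β : ℝ := lam ^ 2 * f lam with hβdef
  have hβ : 0 < β := by positivity
  have hβle : β ≤ lam ^ 2 := by
    have : lam ^ 2 * f lam ≤ lam ^ 2 * 1 := mul_le_mul_of_nonneg_left hfl1 (sq_nonneg lam)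
    simpa [hβdef] using this
  -- `Q(0,1) = Φ⁻¹(]-β,0[ × B(0,λ))`
  have hpre : stAffine β lam 0 (0 : EuclideanSpace ℝ (Fin 3)) ⁻¹'
      (Ioo (-β) 0 ×ˢ ball (0 : EuclideanSpace ℝ (Fin 3)) lam) =
      parabolicCylinder 1 (0 : ℝ × EuclideanSpace ℝ (Fin 3)) := by
    rw [stAffine_preimage_cylinder hβ hlam, SuitableCompactness.parabolicCylinder_zero]
    congr 1
    · rw [sub_zero, sub_zero, zero_div, neg_div, div_self hβ.ne']; norm_num
    · rw [sub_zero, smul_zero, div_self hlam.ne']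
  have hF : (fun z : ℝ × EuclideanSpace ℝ (Fin 3) => ENNReal.ofReal (frobeniusNormSq
      (((lam * f lam * lam) • stPull (lam ^ 2 * f lam) lam 0 (0 : EuclideanSpace ℝ (Fin 3)) G)
        z.1 z.2))) =
      fun z => (fun w : ℝ × EuclideanSpace ℝ (Fin 3) => ENNReal.ofReal ((lam * f lam * lam) ^ 2) *
        ENNReal.ofReal (frobeniusNormSq (G w.1 w.2))) (stAffine β lam 0 (0 : EuclideanSpace ℝ (Fin 3)) z) := by
    funext z
    simp only [Pi.smul_apply, stPull_apply, stAffine_fst, stAffine_snd, frobeniusNormSq_smul, zero_add,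
      hβdef]
    rw [ENNReal.ofReal_mul (sq_nonneg _)]
  rw [hF, ← hpre, setLIntegral_preimage_comp_stAffine (E := EuclideanSpace ℝ (Fin 3)) hβ hlam 0 0
    (fun w : ℝ × EuclideanSpace ℝ (Fin 3) => ENNReal.ofReal ((lam * f lam * lam) ^ 2) *
      ENNReal.ofReal (frobeniusNormSq (G w.1 w.2))) (Ioo (-β) 0 ×ˢ ball (0 : EuclideanSpace ℝ (Fin 3)) lam),
    finrank_euclideanSpace_fin, lintegral_const_mul' _ _ ENNReal.ofReal_ne_top, ← mul_assoc,
    ← ENNReal.ofReal_mul (by positivity)]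
  -- the window lies in `Q(0, λ)` and the constant is `f(λ)/λ`
  have hwin : Ioo (-β) 0 ×ˢ ball (0 : EuclideanSpace ℝ (Fin 3)) lam ⊆
      parabolicCylinder lam (0 : ℝ × EuclideanSpace ℝ (Fin 3)) := by
    rw [SuitableCompactness.parabolicCylinder_zero]
    exact prod_mono (Ioo_subset_Ioo (by linarith) le_rfl) Subset.rfl
  have hconst : (β * lam ^ 3)⁻¹ * (lam * f lam * lam) ^ 2 = f lam / lam := by
    rw [hβdef]; field_simp
  rw [hconst]
  unfold weightedE
  exact mul_le_mul_right (lintegral_mono_set hwin) _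

/-- The exponent bookkeeping of (2.8): with `α = λf`, `β = λ²f`, `r = λ√f`, `κ = κ(s,l)`,
`((λ³)⁻¹ α^s)^{l/s} β⁻¹ = f^{(l/2)(1+3/s)} r^{-κ}` (i.e. `λ^{l-3l/s-2+κ} = 1` and
`f^{l-1+κ/2} = f^{(l/2)(1+3/s)}`). [cite: Seregin2026, (2.8) (p. 6)] -/
theorem zoomConst_floor (hlam : 0 < lam) (hfl : 0 < fl) {s l : ℝ} (hs : s ≠ 0) (hl : l ≠ 0) :
    ((lam ^ 3)⁻¹ * (lam * fl) ^ s) ^ (l / s) * (lam ^ 2 * fl)⁻¹ =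
      fl ^ (l / 2 * (1 + 3 / s)) * (lam * Real.sqrt fl) ^ (-kappa s l) := by
  set L : ℝ := Real.log lam with hL
  set M : ℝ := Real.log fl with hM
  have e1 : (lam ^ 3)⁻¹ = Real.exp (-(3 * L)) := by
    rw [hL, ← Real.rpow_natCast lam 3, Real.rpow_def_of_pos hlam, ← Real.exp_neg]
    congr 1; push_cast; ring
  have e2 : (lam * fl) ^ s = Real.exp ((L + M) * s) := by
    rw [Real.rpow_def_of_pos (mul_pos hlam hfl), Real.log_mul hlam.ne' hfl.ne']
  have e3 : (lam ^ 2 * fl)⁻¹ = Real.exp (-(2 * L + M)) := by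
    rw [Real.exp_neg, Real.exp_add, hL, hM, Real.exp_log hfl, ← Real.rpow_natCast lam 2,
      Real.rpow_def_of_pos hlam]
    have e : Real.log lam * ((2 : ℕ) : ℝ) = 2 * Real.log lam := by push_cast; ring
    rw [e]
  have e4 : fl ^ (l / 2 * (1 + 3 / s)) = Real.exp (M * (l / 2 * (1 + 3 / s))) := by
    rw [Real.rpow_def_of_pos hfl]
  have e5 : (lam * Real.sqrt fl) ^ (-kappa s l) = Real.exp ((L + M / 2) * (-kappa s l)) := by
    rw [Real.rpow_def_of_pos (mul_pos hlam (Real.sqrt_pos.2 hfl)),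
      Real.log_mul hlam.ne' (Real.sqrt_pos.2 hfl).ne', Real.log_sqrt hfl.le]
  rw [e1, e2, ← Real.exp_add, Real.rpow_def_of_pos (Real.exp_pos _), Real.log_exp, e3, e4, e5,
    ← Real.exp_add, ← Real.exp_add]
  congr 1
  unfold kappa
  field_simp
  ring

/-- **(2.8): the scenario functional under the zoom.** For `r = λ √(f(λ))` (so that the zoomed
unit time window `]-1,0[` corresponds to `]-r², 0[`),
`∫_{-1}^0 (∫_{B(0,√f(λ))} |v^λ|^s dy)^{l/s} dτ = f(λ)^{(l/2)(1+3/s)} M^{s,l}_κ(v, r)`.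
[cite: Seregin2026, (2.8) (p. 6) and (3.4) (p. 9)] -/
theorem zoom_floor_eq (hlam : 0 < lam) {f : ℝ → ℝ} (hfl : 0 < f lam) {s l : ℝ} (hs : 0 < s)
    (hl : 0 < l) (v : ℝ → EuclideanSpace ℝ (Fin 3) → EuclideanSpace ℝ (Fin 3)) :
    ∫⁻ t in Ioo (-1 : ℝ) 0, (∫⁻ x in ball (0 : EuclideanSpace ℝ (Fin 3)) (Real.sqrt (f lam)),
        ‖((lam * f lam) • stPull (lam ^ 2 * f lam) lam 0 (0 : EuclideanSpace ℝ (Fin 3)) v) t x‖ₑ ^ s)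
          ^ (l / s) =
      ENNReal.ofReal (f lam ^ (l / 2 * (1 + 3 / s))) *
        morreyM (kappa s l) s l (0 : ℝ × EuclideanSpace ℝ (Fin 3)) v (lam * Real.sqrt (f lam)) := by
  have hρ : 0 < Real.sqrt (f lam) := Real.sqrt_pos.2 hfl
  have hρ2 : Real.sqrt (f lam) ^ 2 = f lam := Real.sq_sqrt hfl.le
  have hr : 0 < lam * Real.sqrt (f lam) := mul_pos hlam hρ
  have hβ : 0 < lam ^ 2 * f lam := by positivity
  have hβr : lam ^ 2 * f lam = (lam * Real.sqrt (f lam)) ^ 2 := by rw [mul_pow, hρ2]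
  have hα : 0 < lam * f lam := by positivity
  have hls : 0 ≤ l / s := div_nonneg hl.le hs.le
  -- the slice functional of `v` at radius `r`
  set V : ℝ → ℝ≥0∞ := fun τ => ∫⁻ y in ball (0 : EuclideanSpace ℝ (Fin 3)) (lam * Real.sqrt (f lam)),
    ‖v τ y‖ₑ ^ s with hV
  set c₁ : ℝ≥0∞ := (ENNReal.ofReal (lam ^ 3)⁻¹ * ENNReal.ofReal (lam * f lam) ^ s) ^ (l / s) with hc₁
  have hc₁top : c₁ ≠ ∞ := ENNReal.rpow_ne_top_of_nonneg hls (ENNReal.mul_ne_top ENNReal.ofReal_ne_top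
    (ENNReal.rpow_ne_top_of_nonneg hs.le ENNReal.ofReal_ne_top))
  -- (i)–(ii): the zoomed slice functional is `c₁ · V(βt)^{l/s}`
  have hslice : ∀ t : ℝ, (∫⁻ x in ball (0 : EuclideanSpace ℝ (Fin 3)) (Real.sqrt (f lam)),
      ‖((lam * f lam) • stPull (lam ^ 2 * f lam) lam 0 (0 : EuclideanSpace ℝ (Fin 3)) v) t x‖ₑ ^ s)
        ^ (l / s) = c₁ * V (lam ^ 2 * f lam * t) ^ (l / s) := by
    intro t
    have hF : (fun x : EuclideanSpace ℝ (Fin 3) =>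
        ‖((lam * f lam) • stPull (lam ^ 2 * f lam) lam 0 (0 : EuclideanSpace ℝ (Fin 3)) v) t x‖ₑ ^ s) =
        fun x => (fun y : EuclideanSpace ℝ (Fin 3) => ENNReal.ofReal (lam * f lam) ^ s *
          ‖v (lam ^ 2 * f lam * t) y‖ₑ ^ s) (lam • x) := by
      funext x
      simp only [smul_stPull_apply, zero_add, enorm_smul, Real.enorm_eq_ofReal hα.le]
      rw [ENNReal.mul_rpow_of_nonneg _ _ hs.le]
    rw [hF, setLIntegral_ball_comp_smul hlam (Real.sqrt (f lam)) (fun y : EuclideanSpace ℝ (Fin 3) =>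
      ENNReal.ofReal (lam * f lam) ^ s * ‖v (lam ^ 2 * f lam * t) y‖ₑ ^ s), lintegral_const_mul' _ _
      (ENNReal.rpow_ne_top_of_nonneg hs.le ENNReal.ofReal_ne_top), ← mul_assoc,
      ENNReal.mul_rpow_of_nonneg _ _ hls]
  simp_rw [hslice]
  -- (iii): time substitution
  rw [lintegral_const_mul' _ _ hc₁top,
    setLIntegral_Ioo_comp_mul hβ (-1) 0 (fun τ => V τ ^ (l / s)), mul_neg_one, mul_zero, ← mul_assoc]
  -- (iv)–(v): constants and the definition of `M^{s,l}_κ`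
  have hconst : c₁ * ENNReal.ofReal (lam ^ 2 * f lam)⁻¹ = ENNReal.ofReal (f lam ^ (l / 2 * (1 + 3 / s))) *
      ENNReal.ofReal ((lam * Real.sqrt (f lam)) ^ (-kappa s l)) := by
    rw [hc₁, ENNReal.ofReal_rpow_of_pos hα,
      ← ENNReal.ofReal_mul (by positivity), ENNReal.ofReal_rpow_of_nonneg (by positivity) hls,
      ← ENNReal.ofReal_mul (by positivity), ← ENNReal.ofReal_mul (by positivity),
      zoomConst_floor hlam hfl hs.ne' hl.ne']
  have hMor : morreyM (kappa s l) s l (0 : ℝ × EuclideanSpace ℝ (Fin 3)) v (lam * Real.sqrt (f lam)) =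
      ENNReal.ofReal ((lam * Real.sqrt (f lam)) ^ (-kappa s l)) *
        ∫⁻ τ in Ioo (-(lam * Real.sqrt (f lam)) ^ 2) 0, V τ ^ (l / s) := by
    unfold morreyM
    rw [Prod.fst_zero, Prod.snd_zero, zero_sub]
  rw [hconst, hMor, hβr, mul_assoc]

end Zoom

/-! ## C. The inverse of `φ(λ) = λ√f(λ)` (continuity!), the statement and the proof -/

section Assembly

/-- **The step that needs continuity of `f`.** For `f` continuous and strictly increasing on
`]0,1]` with values in `]0,1]` and `f(1) = 1`, the zoom scale `φ(λ) = λ √(f(λ))` of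
[Seregin2026] p. 6 ("`r_k = λ_k √(f(λ_k))`") has an inverse `ψ` on `]0,1]`:
`ψ(r) ∈ ]0,1]`, `ψ(r) √(f(ψ(r))) = r`, and `ψ(r) → 0⁺` as `r → 0⁺` (intermediate value theorem on
`[r/2, 1]`, where `φ(r/2) ≤ r/2 < r ≤ 1 = φ(1)`; monotonicity of `φ`).
[cite: Seregin2026, proof of Thm 2.1, p. 6 (choice of `λ_k`)] -/
theorem exists_inverse_zoomScale {f : ℝ → ℝ} (hmono : StrictMonoOn f (Ioc (0 : ℝ) 1))
    (hmaps : ∀ r ∈ Ioc (0 : ℝ) 1, f r ∈ Ioc (0 : ℝ) 1) (hf1 : f 1 = 1)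
    (hcont : ContinuousOn f (Ioc (0 : ℝ) 1)) :
    ∃ ψ : ℝ → ℝ, (∀ r ∈ Ioc (0 : ℝ) 1, ψ r ∈ Ioc (0 : ℝ) 1 ∧ ψ r * Real.sqrt (f (ψ r)) = r) ∧
      Tendsto ψ (𝓝[>] 0) (𝓝[>] 0) := by
  classical
  set φ : ℝ → ℝ := fun lam => lam * Real.sqrt (f lam) with hφ
  have hφcont : ContinuousOn φ (Ioc (0 : ℝ) 1) :=
    continuousOn_id.mul (Real.continuous_sqrt.comp_continuousOn hcont)
  have hφpos : ∀ lam ∈ Ioc (0 : ℝ) 1, 0 < φ lam := fun lam hlam =>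
    mul_pos hlam.1 (Real.sqrt_pos.2 (hmaps lam hlam).1)
  have hφle : ∀ lam ∈ Ioc (0 : ℝ) 1, φ lam ≤ lam := fun lam hlam => by
    have h1 : Real.sqrt (f lam) ≤ 1 := by
      rw [← Real.sqrt_one]; exact Real.sqrt_le_sqrt (hmaps lam hlam).2
    simpa [hφ] using mul_le_of_le_one_right hlam.1.le h1
  have hφ1 : φ 1 = 1 := by simp [hφ, hf1]
  have hφmono : StrictMonoOn φ (Ioc (0 : ℝ) 1) := by
    intro a ha b hb hab
    have h1 : Real.sqrt (f a) ≤ Real.sqrt (f b) := Real.sqrt_le_sqrt (hmono ha hb hab).le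
    have h2 : 0 < Real.sqrt (f a) := Real.sqrt_pos.2 (hmaps a ha).1
    calc a * Real.sqrt (f a) < b * Real.sqrt (f a) := mul_lt_mul_of_pos_right hab h2
      _ ≤ b * Real.sqrt (f b) := mul_le_mul_of_nonneg_left h1 hb.1.le
  -- surjectivity onto `]0,1]`
  have hsurj : ∀ r ∈ Ioc (0 : ℝ) 1, ∃ lam ∈ Ioc (0 : ℝ) 1, φ lam = r := by
    intro r hr
    have ha : r / 2 ∈ Ioc (0 : ℝ) 1 := ⟨by linarith [hr.1], by linarith [hr.2]⟩
    have hsub : Icc (r / 2) 1 ⊆ Ioc (0 : ℝ) 1 := fun x hx => ⟨lt_of_lt_of_le ha.1 hx.1, hx.2⟩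
    have hivt := intermediate_value_Icc ha.2 (hφcont.mono hsub)
    have hmem : r ∈ Icc (φ (r / 2)) (φ 1) :=
      ⟨(hφle _ ha).trans (by linarith [hr.1]), by rw [hφ1]; exact hr.2⟩
    obtain ⟨lam, hlam, hlamr⟩ := hivt hmem
    exact ⟨lam, hsub hlam, hlamr⟩
  choose! Ψ hΨmem hΨeq using hsurj
  refine ⟨Ψ, fun r hr => ⟨hΨmem r hr, hΨeq r hr⟩, ?_⟩
  -- `Ψ(r) → 0⁺`
  have hev : ∀ᶠ r in 𝓝[>] (0 : ℝ), r ∈ Ioc (0 : ℝ) 1 := Ioc_mem_nhdsGT one_pos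
  refine tendsto_nhdsWithin_iff.2 ⟨?_, hev.mono fun r hr => (hΨmem r hr).1⟩
  refine tendsto_order.2 ⟨fun a ha => hev.mono fun r hr => ha.trans (hΨmem r hr).1, fun b hb => ?_⟩
  set δ : ℝ := min b 1 with hδ
  have hδmem : δ ∈ Ioc (0 : ℝ) 1 := ⟨lt_min hb one_pos, min_le_right _ _⟩
  have hev2 : ∀ᶠ r in 𝓝[>] (0 : ℝ), r ∈ Ioo (0 : ℝ) (φ δ) := Ioo_mem_nhdsGT (hφpos δ hδmem)
  filter_upwards [hev, hev2] with r hr hr2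
  have hlt : Ψ r < δ := by
    by_contra hge
    rw [not_lt] at hge
    have := hφmono.le_iff_le hδmem (hΨmem r hr) |>.2 hge
    rw [hΨeq r hr] at this
    exact absurd hr2.2 (not_lt.2 this)
  exact hlt.trans_le (min_le_left _ _)

/-- The exponents `p(η)`: `1/p(η) = η/6 + 3(1-η)/10 ∈ [1/6, 3/10]`, so `2 ≤ 10/3 ≤ p(η) ≤ 6` for
`0 ≤ η ≤ 1`. [cite: Seregin2026, (2.1) (p. 5)] -/
theorem two_le_pEta_and_pEta_le_six {η : ℝ} (hη : η ∈ Icc (0 : ℝ) 1) :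
    2 ≤ pEta η ∧ pEta η ≤ 6 := by
  have h0 : 0 < η / 6 + 3 * (1 - η) / 10 := by linarith [hη.1, hη.2]
  unfold pEta
  constructor
  · rw [le_inv_comm₀ two_pos h0]; linarith [hη.1, hη.2]
  · rw [inv_le_comm₀ h0 (by norm_num)]; linarith [hη.1, hη.2]

/-- `3/2 - 3/p(η) = 2/q(η)` (the line `3/p + 2/q = 3/2` of (2.1)). [cite: Seregin2026, §2 p. 5 (after (2.1))] -/
theorem three_halves_sub_three_div_pEta (η : ℝ) : 3 / 2 - 3 / pEta η = 2 / qEta η := by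
  unfold pEta qEta
  rw [div_inv_eq_mul, div_inv_eq_mul]
  ring

/-- **Seregin 2026, Theorem 2.1, for continuous scenario weights** (the corrected statement; see
the module docstring for the gap in the printed one). "Let a pair `v` and `q` be a suitable weak
solution to the Navier–Stokes equations in `Q`. It is supposed that this pair obeys condition
(1.7). Assume further that, for some numbers `s` and `l`, satisfying inequalities (1.4)
[`l > κ := l(3/s + 2/l - 1) > 0`, `s > 1`, `l > 1`], the additional restrictions `s < p(η)`,
`l < q(η)` (2.3) hold with some parameter `0 ≤ η ≤ 1`. Suppose also that
`(f(λ))^{(l/2)(1+3/s) - (3/2)(1 - s/p(η))(l/s)} (g(λ√f(λ)))^{-1} → ∞` as `λ → 0` (2.4). Then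
`lim_{r→0} g(r) M^{s,l}_κ(v, r) = 0` (2.5)." — with the scenario weight `f` (§1 p. 4, (2.2):
increasing, `f(0+) = 0`, `f(1) = 1`, limit ratio `F > 0`; tree `IsScenarioWeight`) assumed in
addition CONTINUOUS on `]0,1]` (used on p. 6 to solve `r = λ√f(λ)`; all weights of the source,
`r^{1-m}`, `1/ln^γ(e/λ)`, `λ^{α-1}/ln^γ(e/λ)`, are continuous). Rendering otherwise verbatim that of
the named fact `seregin2026_typeII_scenario_excluded` (`TypeIIEulerZoomScenario.lean`).
[cite: Seregin2026, Thm 2.1 (p. 5) with (1.4), (1.7), (2.2)–(2.4), proof pp. 6–7] -/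
def seregin2026_typeII_scenario_excluded_continuousWeight : Prop :=
  ∀ (v : ℝ → EuclideanSpace ℝ (Fin 3) → EuclideanSpace ℝ (Fin 3))
    (q : ℝ → EuclideanSpace ℝ (Fin 3) → ℝ)
    (G : ℝ → EuclideanSpace ℝ (Fin 3) → EuclideanSpace ℝ (Fin 3) →L[ℝ] EuclideanSpace ℝ (Fin 3))
    (f F g : ℝ → ℝ) (s l η : ℝ),
    IsSuitableWeakSolutionInBall 1 0 v q →
    HasWeakSpatialGradientOn (parabolicCylinderOpens 1 (0 : ℝ × EuclideanSpace ℝ (Fin 3))) v G →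
    IsScenarioWeight f F →
    ContinuousOn f (Ioc (0 : ℝ) 1) →
    (∃ M₁ : ℝ≥0, HasWeightedEnergyBound f M₁ v q G) →
    (∀ r ∈ Ioo (0 : ℝ) 1, 0 < g r) →
    1 < s → 1 < l → 0 < kappa s l → kappa s l < l →
    η ∈ Icc (0 : ℝ) 1 → s < pEta η → l < qEta η →
    Tendsto
      (fun lam : ℝ =>
        f lam ^ (l / 2 * (1 + 3 / s) - 3 / 2 * (1 - s / pEta η) * (l / s)) *
          (g (lam * Real.sqrt (f lam)))⁻¹)
      (𝓝[>] 0) atTop →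
    Tendsto
      (fun r : ℝ =>
        ENNReal.ofReal (g r) * morreyM (kappa s l) s l (0 : ℝ × EuclideanSpace ℝ (Fin 3)) v r)
      (𝓝[>] 0) (𝓝 0)

/-- The corrected statement is the typed one with one MORE hypothesis (continuity of `f`), hence
is implied by it: `seregin2026_typeII_scenario_excluded → …_continuousWeight` (binder-by-binder;
this also documents that the rendering is otherwise verbatim). [cite: Seregin2026, Thm 2.1 (p. 5)] -/
theorem seregin2026_typeII_scenario_excluded_continuousWeight_of_excluded
    (h : seregin2026_typeII_scenario_excluded) :
    seregin2026_typeII_scenario_excluded_continuousWeight :=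
  fun v q G f F g s l η hv hG hfF _ hb hg hs hl hκ hκl hη hsp hlq h24 =>
    h v q G f F g s l η hv hG hfF hb hg hs hl hκ hκl hη hsp hlq h24

/-- **Proof of Theorem 2.1 (continuous weights)**, following [Seregin2026] pp. 6–7: for every
`0 < λ < 1`, (2.9) at `a = 1` and the unit-cylinder estimate give
`∫_{-1}^0 (∫_{B(√f(λ))} |v^λ|^s)^{l/s} ≤ C f(λ)^{(3/2)(1 - s/p(η))(l/s)}`, while (2.8) identifies
the left side with `f(λ)^{(l/2)(1+3/s)} M^{s,l}_κ(v, λ√f(λ))`; hence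
`g(λ√f(λ)) M^{s,l}_κ(v, λ√f(λ)) ≤ C / (f(λ)^e g(λ√f(λ))^{-1}) → 0` by (2.4), and the substitution
`r = λ√f(λ)` (`exists_inverse_zoomScale`) gives (2.5). The Navier–Stokes equation, the local
energy inequality and the pressure bound are not used. [cite: Seregin2026, Thm 2.1 (p. 5), proof pp. 6–7] -/
theorem seregin2026_typeII_scenario_excluded_continuousWeight_holds :
    seregin2026_typeII_scenario_excluded_continuousWeight := by
  intro v q G f F g s l η _hv hG hfF hcont hbound hg hs hl _hκ _hκl hη hsp hlq h24
  obtain ⟨M₁, hM⟩ := hbound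
  have hs0 : 0 < s := by linarith
  have hl0 : 0 < l := by linarith
  obtain ⟨h2p, hp6⟩ := two_le_pEta_and_pEta_le_six hη
  have hp0 : 0 < pEta η := lt_of_lt_of_le two_pos h2p
  have hq0 : 0 < qEta η := by linarith
  have hlq' : l * (3 / 2 - 3 / pEta η) < 2 := by
    rw [three_halves_sub_three_div_pEta, mul_div_assoc', div_lt_iff₀ hq0]
    linarith
  -- the constant of the unit-cylinder estimate (A = E = M₁)
  obtain ⟨C, hC⟩ := exists_mixedNorm_smallBall_le M₁ M₁ hs0 hsp h2p hp6 hl0 hlq'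
  -- exponents
  set e₀ : ℝ := l / 2 * (1 + 3 / s) with he₀
  set e₂ : ℝ := 3 / 2 * (1 - s / pEta η) * (l / s) with he₂
  set φ : ℝ → ℝ := fun lam => lam * Real.sqrt (f lam) with hφ
  -- the per-`λ` estimate
  have hmain : ∀ lam ∈ Ioo (0 : ℝ) 1,
      ENNReal.ofReal (g (φ lam)) * morreyM (kappa s l) s l (0 : ℝ × EuclideanSpace ℝ (Fin 3)) v (φ lam) ≤
        (C : ℝ≥0∞) * ENNReal.ofReal ((f lam ^ (e₀ - e₂) * (g (φ lam))⁻¹)⁻¹) := by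
    intro lam hlam
    have hfl : f lam ∈ Ioc (0 : ℝ) 1 := hfF.mapsTo lam ⟨hlam.1, hlam.2.le⟩
    have hρ : 0 < Real.sqrt (f lam) := Real.sqrt_pos.2 hfl.1
    have hρ1 : Real.sqrt (f lam) ≤ 1 := by
      rw [← Real.sqrt_one]; exact Real.sqrt_le_sqrt hfl.2
    have hφmem : φ lam ∈ Ioo (0 : ℝ) 1 := by
      refine ⟨mul_pos hlam.1 hρ, ?_⟩
      calc lam * Real.sqrt (f lam) ≤ lam * 1 := mul_le_mul_of_nonneg_left hρ1 hlam.1.le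
        _ < 1 := by linarith [hlam.2]
    have hgpos : 0 < g (φ lam) := hg _ hφmem
    -- (2.9) at `a = 1`
    have hsum := hM lam hlam
    have hA1 : weightedA f lam (0 : ℝ × EuclideanSpace ℝ (Fin 3)) v ≤ (M₁ : ℝ≥0∞) :=
      le_self_add.trans (le_self_add.trans hsum)
    have hE1 : weightedE f lam (0 : ℝ × EuclideanSpace ℝ (Fin 3)) G ≤ (M₁ : ℝ≥0∞) :=
      le_add_self.trans (le_self_add.trans hsum)
    have hAe := zoom_slice_energy_le hlam.1 hfl.1 hfl.2 hA1
    have hEe := (zoom_grad_le (G := G) hlam.1 hfl.1 hfl.2).trans hE1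
    have hGw := zoom_hasWeakSpatialGradientOn hlam.1 hlam.2.le hfl.1 hfl.2 hG
    -- the unit-cylinder estimate for the zoomed field on `B(√f(λ))`
    have hJ := hC _ _ hGw hAe hEe (Real.sqrt (f lam)) ⟨hρ, hρ1⟩
    rw [zoom_floor_eq hlam.1 hfl.1 hs0 hl0 v] at hJ
    -- `√f^{3l(1/s-1/p)} = f^{e₂}`
    have hexp : Real.sqrt (f lam) ^ (3 * l * (1 / s - 1 / pEta η)) = f lam ^ e₂ := by
      rw [Real.sqrt_eq_rpow, ← Real.rpow_mul hfl.1.le]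
      congr 1
      rw [he₂]; field_simp
    rw [hexp] at hJ
    -- divide by `f^{e₀}`: `M ≤ C f^{e₂ - e₀} = C (f^{e₀-e₂})⁻¹`
    have hfe₀ : 0 < f lam ^ e₀ := Real.rpow_pos_of_pos hfl.1 _
    have hdiv : morreyM (kappa s l) s l (0 : ℝ × EuclideanSpace ℝ (Fin 3)) v (φ lam) ≤
        (C : ℝ≥0∞) * ENNReal.ofReal ((f lam ^ (e₀ - e₂))⁻¹) := by
      have h1 : morreyM (kappa s l) s l (0 : ℝ × EuclideanSpace ℝ (Fin 3)) v (φ lam) ≤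
          ((C : ℝ≥0∞) * ENNReal.ofReal (f lam ^ e₂)) / ENNReal.ofReal (f lam ^ e₀) := by
        rw [ENNReal.le_div_iff_mul_le (Or.inl ((ENNReal.ofReal_pos.2 hfe₀).ne'))
          (Or.inl ENNReal.ofReal_ne_top), mul_comm]
        exact hJ
      refine h1.trans (le_of_eq ?_)
      rw [mul_div_assoc, ← ENNReal.ofReal_div_of_pos hfe₀, ← Real.rpow_sub hfl.1,
        ← Real.rpow_neg hfl.1.le]
      congr 2
      ring
    -- multiply by `g(φ(λ))`
    calc ENNReal.ofReal (g (φ lam)) * morreyM (kappa s l) s l (0 : ℝ × EuclideanSpace ℝ (Fin 3)) v (φ lam)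
        ≤ ENNReal.ofReal (g (φ lam)) * ((C : ℝ≥0∞) * ENNReal.ofReal ((f lam ^ (e₀ - e₂))⁻¹)) := by
          gcongr
      _ = (C : ℝ≥0∞) * ENNReal.ofReal ((f lam ^ (e₀ - e₂) * (g (φ lam))⁻¹)⁻¹) := by
          rw [mul_left_comm, ← ENNReal.ofReal_mul hgpos.le, mul_inv, inv_inv, mul_comm (g (φ lam))]
  -- the limit along `λ → 0⁺` (this is where (2.4) enters)
  have hT : Tendsto (fun lam : ℝ => ENNReal.ofReal (g (φ lam)) *
      morreyM (kappa s l) s l (0 : ℝ × EuclideanSpace ℝ (Fin 3)) v (φ lam)) (𝓝[>] 0) (𝓝 0) := by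
    have h1 : Tendsto (fun lam : ℝ => (f lam ^ (e₀ - e₂) * (g (φ lam))⁻¹)⁻¹) (𝓝[>] 0) (𝓝 0) :=
      h24.inv_tendsto_atTop
    have h2 : Tendsto (fun lam : ℝ => (C : ℝ≥0∞) *
        ENNReal.ofReal ((f lam ^ (e₀ - e₂) * (g (φ lam))⁻¹)⁻¹)) (𝓝[>] 0) (𝓝 0) := by
      have h := ENNReal.Tendsto.const_mul (a := (C : ℝ≥0∞)) (ENNReal.tendsto_ofReal h1)
        (Or.inr ENNReal.coe_ne_top)
      rwa [ENNReal.ofReal_zero, mul_zero] at h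
    refine tendsto_of_tendsto_of_tendsto_of_le_of_le' tendsto_const_nhds h2
      (Eventually.of_forall fun _ => bot_le) ?_
    filter_upwards [Ioo_mem_nhdsGT one_pos] with lam hlam
    exact hmain lam hlam
  -- the substitution `r = φ(λ)`, `λ = ψ(r)` (continuity of `f`)
  obtain ⟨ψ, hψ, hψt⟩ := exists_inverse_zoomScale hfF.strictMonoOn hfF.mapsTo hfF.map_one hcont
  refine (hT.comp hψt).congr' ?_
  filter_upwards [Ioc_mem_nhdsGT one_pos] with r hr
  simp only [comp_apply, hφ, (hψ r hr).2]

end Assembly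

end Literature.Analysis.FluidPDE.Seregin2023

end
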